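import Summits.HubbardSuperconductivity.HubbardSuperconductivity.Theses.InfiniteVolumeFirst
import Literature.MathematicalPhysics.QuantumLattice.HubbardTorusFlux

/-!
# Crux `NoInfraredPileUp` (stmt-HubbardSuperconductivity-18534) — redirect strategist r1:
# typed objects for `STRATEGY-CENSUS.md` (r1) §Strengthen / §Decomposition

Nothing in this file is filed as an item. It TYPES (and, for the glue, PROVES) the objects the r1
census refers to, so that "no leverage" is said about precise statements:

* §1 the SCALE SPLIT of the load-bearing half Sub₁ (`NoSlidingAt`, per coupling): `LowModesAt`
  (no macroscopic `d`-wave pair weight at the finitely many lowest nonzero momenta `|q_m| ≤ A/L`, for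
  every fixed `A`, when the zero mode is small — the `O(1)`-energy enemy class: windings / LSM boosts,
  lowest-mode phase-phonon number states) and `MesoAt` (no macroscopic weight at mesoscopic momenta
  `A/L < |q_m| ≤ ε` for SOME `A` — the divergent-but-subextensive class: quasi-condensates of
  coherence length `o(L)`, vortex gases), with the glue `noSlidingAt_of_low_of_meso` PROVED
  (term-wise case split; `θ := min`, `L₀ := max`);
* §2 the strengthenings examined in the census as signatures: `HelicityFloorAt` (positive helicity
  modulus of the sector energy under a uniform twist, to `o(1)` — the flux formulation of
  superconductivity itself), `GroundCurrentVanishesAt` (improved Bloch law `J̃(GS) = o(L)`),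
  `WindowGapAt` (a uniform `c/L` gap above the ground state inside the window momentum sectors — the
  tower/rigidity strengthening).
-/

noncomputable section

set_option linter.dupNamespace false

namespace Summit.HubbardSuperconductivity.HubbardSuperconductivity.Cruxes.NoInfraredPileUp.StrategistR1

open Literature.MathematicalPhysics.QuantumLattice Literature.Probability.LatticeModels Matrix Finset
  Filter
open Summit.HubbardSuperconductivity.HubbardSuperconductivity.Theses.InfiniteVolumeFirst
open scoped ComplexOrder Topology

/-- Admissibility (as in `SummitStrengthR1.lean`). [folklore] -/
def Admissible' (U δ : ℝ) (N : ℕ → ℕ) (ψ : ∀ L, Fock (Orb (FermionTorus 2 L))) : Prop :=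
  ∀ L, Even L → N L = 2 * ⌊(1 - δ) * (L : ℝ) ^ 2 / 2⌋₊ ∧ star (ψ L) ⬝ᵥ ψ L = 1 ∧
    IsGroundStateInSector (hubbardTorus 2 L 1 U) (N L) 0 (ψ L)

/-- Sub₁ per coupling (as in `SummitStrengthR1.lean`). [folklore] -/
def NoSlidingAt' (U δ : ℝ) : Prop :=
  ∀ (N : ℕ → ℕ) (ψ : ∀ L, Fock (Orb (FermionTorus 2 L))), Admissible' U δ N ψ →
    ∀ η : ℝ, 0 < η → ∃ θ : ℝ, 0 < θ ∧ ∃ ε : ℝ, 0 < ε ∧ ∃ L₀ : ℕ, ∀ (L : ℕ) [NeZero L],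
      Even L → L₀ ≤ L →
        pairStructureFactor dWaveFormFactor L (ψ L) 0 ≤ θ * (L : ℝ) ^ 2 →
          (∑ m : Fin 2 → ZMod L, if m ≠ 0 ∧ momentumNormSq L m ≤ ε ^ 2 then
              pairStructureFactor dWaveFormFactor L (ψ L) m else 0) ≤ η * (L : ℝ) ^ 2

/-! ### §1 The scale split of Sub₁ -/

/-- **Low modes** (`O(1)`-energy class). For every fixed `A > 0`: when the zero mode is small, the
finitely many (`≈ A²/π`) lowest nonzero momenta `|q_m| ≤ A/L` (i.e. `L²|q_m|² ≤ A²`) carry no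
macroscopic `d`-wave pair weight, eventually. The LSM-boosted condensates (`|q| = 4πk/L`), odd-flux
windings (`|q| = 2π(2k+1)/L`) and the lowest phase-phonon number states all live here; each is `O(1)`
in TOTAL energy above a uniform condensate (`≈ 2π²D_s k²`, `2π²ρ_s n/L·L`), so any proof needs the exact
eigen-equation at `O(1)` resolution (`Negative/NearGroundStates`). [folklore] -/
def LowModesAt (U δ : ℝ) : Prop :=
  ∀ (N : ℕ → ℕ) (ψ : ∀ L, Fock (Orb (FermionTorus 2 L))), Admissible' U δ N ψ →
    ∀ A : ℝ, 0 < A → ∀ η : ℝ, 0 < η → ∃ θ : ℝ, 0 < θ ∧ ∃ L₀ : ℕ, ∀ (L : ℕ) [NeZero L],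
      Even L → L₀ ≤ L →
        pairStructureFactor dWaveFormFactor L (ψ L) 0 ≤ θ * (L : ℝ) ^ 2 →
          (∑ m : Fin 2 → ZMod L, if m ≠ 0 ∧ (L : ℝ) ^ 2 * momentumNormSq L m ≤ A ^ 2 then
              pairStructureFactor dWaveFormFactor L (ψ L) m else 0) ≤ η * (L : ℝ) ^ 2

/-- **Mesoscopic modes** (divergent-subextensive class). For every `η` there is a scale `A` such that,
when the zero mode is small, the momenta `A/L < |q_m| ≤ ε` carry at most `ηL²` of `d`-wave pair weight,
eventually. Enemies: quasi-condensates with coherence length `ℓ_L → ∞`, `ℓ_L = o(L)` (weight at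
`|q| ~ 1/ℓ_L`, kinetic cost `≈ ρ_s (L/ℓ_L)² → ∞` but `o(L²)`), dilute vortex gases (`k log L`). Invisible to
energy-DENSITY methods (cost `o(L²)`) and to exact variational identities (teeth `O(1)`): no method in
print resolves this intermediate range for an interacting quantum lattice model at `T = 0` either.
[folklore] -/
def MesoAt (U δ : ℝ) : Prop :=
  ∀ (N : ℕ → ℕ) (ψ : ∀ L, Fock (Orb (FermionTorus 2 L))), Admissible' U δ N ψ →
    ∀ η : ℝ, 0 < η → ∃ A : ℝ, 0 < A ∧ ∃ θ : ℝ, 0 < θ ∧ ∃ ε : ℝ, 0 < ε ∧ ∃ L₀ : ℕ,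
      ∀ (L : ℕ) [NeZero L], Even L → L₀ ≤ L →
        pairStructureFactor dWaveFormFactor L (ψ L) 0 ≤ θ * (L : ℝ) ^ 2 →
          (∑ m : Fin 2 → ZMod L,
              if m ≠ 0 ∧ A ^ 2 < (L : ℝ) ^ 2 * momentumNormSq L m ∧ momentumNormSq L m ≤ ε ^ 2 then
                pairStructureFactor dWaveFormFactor L (ψ L) m else 0) ≤ η * (L : ℝ) ^ 2

/-- Term-wise: a window summand is a low summand or a meso summand (nonnegative weights). [folklore] -/
theorem window_term_le {L : ℕ} [NeZero L] (φ : Fock (Orb (FermionTorus 2 L))) (A ε : ℝ)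
    (m : Fin 2 → ZMod L) :
    (if m ≠ 0 ∧ momentumNormSq L m ≤ ε ^ 2 then pairStructureFactor dWaveFormFactor L φ m else 0) ≤
      (if m ≠ 0 ∧ (L : ℝ) ^ 2 * momentumNormSq L m ≤ A ^ 2 then
          pairStructureFactor dWaveFormFactor L φ m else 0) +
        (if m ≠ 0 ∧ A ^ 2 < (L : ℝ) ^ 2 * momentumNormSq L m ∧ momentumNormSq L m ≤ ε ^ 2 then
          pairStructureFactor dWaveFormFactor L φ m else 0) := by
  have hS : 0 ≤ pairStructureFactor dWaveFormFactor L φ m := pairStructureFactor_nonneg _ _ _ _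
  by_cases h : m ≠ 0 ∧ momentumNormSq L m ≤ ε ^ 2
  · rw [if_pos h]
    by_cases h2 : (L : ℝ) ^ 2 * momentumNormSq L m ≤ A ^ 2
    · rw [if_pos ⟨h.1, h2⟩]
      split_ifs <;> linarith
    · rw [if_neg (fun h' => h2 h'.2), if_pos ⟨h.1, lt_of_not_ge h2, h.2⟩]
      linarith
  · rw [if_neg h]
    split_ifs <;> linarith

/-- **The scale-split glue, proved**: low modes and mesoscopic modes together give Sub₁ at the same
coupling (`A` from `MesoAt` at `η/2`, then `LowModesAt` at that `A` and `η/2`; `θ := min`, `L₀ := max`).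
[folklore] -/
theorem noSlidingAt_of_low_of_meso {U δ : ℝ} (hlow : LowModesAt U δ) (hmeso : MesoAt U δ) :
    NoSlidingAt' U δ := by
  intro N ψ hadm η hη
  obtain ⟨A, hA, θ₂, hθ₂, ε, hε, L₂, h₂⟩ := hmeso N ψ hadm (η / 2) (by linarith)
  obtain ⟨θ₁, hθ₁, L₁, h₁⟩ := hlow N ψ hadm A hA (η / 2) (by linarith)
  refine ⟨min θ₁ θ₂, lt_min hθ₁ hθ₂, ε, hε, max L₁ L₂, fun L _ hL hLL hzero => ?_⟩
  have hL1 : L₁ ≤ L := le_trans (le_max_left _ _) hLL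
  have hL2 : L₂ ≤ L := le_trans (le_max_right _ _) hLL
  have hsq : 0 ≤ (L : ℝ) ^ 2 := sq_nonneg _
  have hz1 : pairStructureFactor dWaveFormFactor L (ψ L) 0 ≤ θ₁ * (L : ℝ) ^ 2 :=
    hzero.trans (mul_le_mul_of_nonneg_right (min_le_left _ _) hsq)
  have hz2 : pairStructureFactor dWaveFormFactor L (ψ L) 0 ≤ θ₂ * (L : ℝ) ^ 2 :=
    hzero.trans (mul_le_mul_of_nonneg_right (min_le_right _ _) hsq)
  have hlowL := h₁ L hL hL1 hz1
  have hmesoL := h₂ L hL hL2 hz2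
  calc (∑ m : Fin 2 → ZMod L, if m ≠ 0 ∧ momentumNormSq L m ≤ ε ^ 2 then
          pairStructureFactor dWaveFormFactor L (ψ L) m else 0)
      ≤ ∑ m : Fin 2 → ZMod L,
          ((if m ≠ 0 ∧ (L : ℝ) ^ 2 * momentumNormSq L m ≤ A ^ 2 then
              pairStructureFactor dWaveFormFactor L (ψ L) m else 0) +
            (if m ≠ 0 ∧ A ^ 2 < (L : ℝ) ^ 2 * momentumNormSq L m ∧ momentumNormSq L m ≤ ε ^ 2 then
              pairStructureFactor dWaveFormFactor L (ψ L) m else 0)) :=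
        Finset.sum_le_sum fun m _ => window_term_le (ψ L) A ε m
    _ = (∑ m : Fin 2 → ZMod L, if m ≠ 0 ∧ (L : ℝ) ^ 2 * momentumNormSq L m ≤ A ^ 2 then
            pairStructureFactor dWaveFormFactor L (ψ L) m else 0) +
          (∑ m : Fin 2 → ZMod L,
            if m ≠ 0 ∧ A ^ 2 < (L : ℝ) ^ 2 * momentumNormSq L m ∧ momentumNormSq L m ≤ ε ^ 2 then
              pairStructureFactor dWaveFormFactor L (ψ L) m else 0) := Finset.sum_add_distrib
    _ ≤ η / 2 * (L : ℝ) ^ 2 + η / 2 * (L : ℝ) ^ 2 := add_le_add hlowL hmesoL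
    _ = η * (L : ℝ) ^ 2 := by ring

/-! ### §2 Strengthenings examined in the census (signatures only; none is filed) -/

/-- **Helicity floor** (S⁺_flux): the `(N_L, 0)`-sector ground energy of the uniformly twisted torus
`hubbardTorusFlux L U Φ` (`fluxEnergy`) exceeds the untwisted one by a positive multiple of
`min(Φ², (2π−Φ)²)` up to `o(1)`, at weak coupling, eventually — Byers–Yang/Kohn superconductivity of the
exact sector energies. Implies flux diamagnetism (DIA of idea meissner-untwisting) and, with London
locking, the winding part of `LowModesAt`; it is the flux formulation of the summit's own content
(route FluxSpectroscopy's `FluxWindow`, stmt-1818, sign half), not a lemma short of it. Byers–Yang, PRL 7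
(1961) 46; Kohn, Phys. Rev. 133 (1964) A171; Scalapino–White–Zhang, PRB 47 (1993) 7995. [folklore] -/
def HelicityFloorAt (U δ : ℝ) : Prop :=
  ∃ c : ℝ, 0 < c ∧ ∀ γ : ℝ, 0 < γ → ∃ L₀ : ℕ, ∀ (L : ℕ) [NeZero L], Even L → L₀ ≤ L →
    ∀ Φ : ℝ, 0 ≤ Φ → Φ ≤ 2 * Real.pi →
      fluxEnergy L U δ 0 + c * min (Φ ^ 2) ((2 * Real.pi - Φ) ^ 2) - γ ≤ fluxEnergy L U δ Φ

/-- **Window gap** (S⁺_tower): a uniform `c/L` gap above the sector ground energy once the ground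
eigenspace is removed — the rigidity/tower strengthening (it would exclude every `o(1/L)`-soft sliding
mode). Stated with the second-lowest Rayleigh value over the orthogonal complement of the ground
eigenspace inside the sector. No supplier (it is the `LROForcesLowLyingStates` direction reversed, and
for nodal `d`-wave it sits exactly at the two-quasiparticle threshold `~ v_Δ/L`). Koma–Tasaki (1994);
Tasaki (2019) §3.2. [folklore] -/
def WindowGapAt (U δ : ℝ) : Prop :=
  ∃ c : ℝ, 0 < c ∧ ∃ L₀ : ℕ, ∀ (L : ℕ) [NeZero L], Even L → L₀ ≤ L →
    ∀ φ : Fock (Orb (FermionTorus 2 L)),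
      φ ∈ szSector (Λ := FermionTorus 2 L) (2 * ⌊(1 - δ) * (L : ℝ) ^ 2 / 2⌋₊) 0 →
        star φ ⬝ᵥ φ = 1 →
          (∀ ψ : Fock (Orb (FermionTorus 2 L)),
              IsGroundStateInSector (hubbardTorus 2 L 1 U) (2 * ⌊(1 - δ) * (L : ℝ) ^ 2 / 2⌋₊) 0 ψ →
                star ψ ⬝ᵥ φ = 0) →
            (hubbardTorus 2 L 1 U).minEnergyOn
                (szSector (Λ := FermionTorus 2 L) (2 * ⌊(1 - δ) * (L : ℝ) ^ 2 / 2⌋₊) 0) + c / (L : ℝ) ≤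
              (star φ ⬝ᵥ (hubbardTorus 2 L 1 U *ᵥ φ)).re

end Summit.HubbardSuperconductivity.HubbardSuperconductivity.Cruxes.NoInfraredPileUp.StrategistR1

end
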